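import Mathlib
import Summits.Ventures.PercRepro2.HalfLA1OBlocks
import Summits.Ventures.PercRepro2.HalfLA2O

/-!
# HALF-L for `a₃ ~ {a₁ o}` (blind cell PercRepro2, night-1 g37)

`GammaLc_a1o`: `ΓLc = 2 · HalfLA1O.lhs (p e₁) (p e₂) (cellsA1O …)` for `CaseOne.IsTwoMarkAt ends a₁ o a₃ e₁ e₂`;
**`HalfL_a1o`**: HALF-L on the class, every weight, every base graph.
-/

namespace Summit.Ventures.PercRepro2

namespace HalfLA1O

open CaseOne CovForm SharpHalves UnionCluster HalfLTwoMark HalfLA2B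

section Main

variable {V : Type*} {E : Type*} [Fintype E] [DecidableEq E] [Fintype V] [DecidableEq V]
  {R : Type*} [Field R] [LinearOrder R] [IsStrictOrderedRing R]
variable {ends : E → Sym2 V} {o a₃ b : V} {e₁ e₂ : E}

omit [Fintype V] in
/-- **`ΓLc` for `a₃ ~ {a₁ o}`**: `ΓLc = 2 · lhs r₁ r₂ (cells)`. -/
theorem GammaLc_a1o (p : E → R) {a₁ a₂ : V} (h : IsTwoMarkAt ends a₁ o a₃ e₁ e₂) (h2 : a₂ ≠ a₃)
    (hb3 : b ≠ a₃) :
    GammaLc p ends o a₁ a₂ a₃ b = 2 * lhs (p e₁) (p e₂) (cellsA1O p ends o a₁ a₂ b e₁ e₂) := by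
  rw [HalfEndpoint.GammaLc_eq_endpoint p ends o a₁ a₂ a₃ b, HalfLTwoMark.Do_eq,
    HalfLTwoMark.avoidAll_eq_Q, HalfLTwoMark.TEvent_eq, HalfLTwoMark.Dtilde_eq]
  have ePD : PDEvent ends a₁ a₂ a₃ =
      (connEvent ends a₁ a₂)ᶜ ∩ (connEvent ends a₃ a₁ ∪ connEvent ends a₃ a₂)ᶜ := rfl
  rw [ePD]
  have cT := prob_inter_add_prob_inter_compl p ((connEvent ends a₁ a₂)ᶜ ∩ connEvent ends a₂ a₃)
    (connEvent ends a₁ o ∪ connEvent ends a₂ o)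
  have cTb := prob_inter_add_prob_inter_compl p
    ((connEvent ends a₁ a₂)ᶜ ∩ connEvent ends a₂ a₃ ∩ connEvent ends a₁ b)
    (connEvent ends a₁ o ∪ connEvent ends a₂ o)
  have eTb : (connEvent ends a₁ a₂)ᶜ ∩ connEvent ends a₂ a₃ ∩
      (connEvent ends a₁ b ∩ (connEvent ends a₁ o ∪ connEvent ends a₂ o)ᶜ) =
      (connEvent ends a₁ a₂)ᶜ ∩ connEvent ends a₂ a₃ ∩ connEvent ends a₁ b ∩
        (connEvent ends a₁ o ∪ connEvent ends a₂ o)ᶜ := (Set.inter_assoc _ _ _).symm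
  have ebLoH : (connEvent ends a₁ a₂)ᶜ ∩ (connEvent ends a₂ o ∩ connEvent ends a₁ b) =
      (connEvent ends a₁ a₂)ᶜ ∩ connEvent ends a₂ o ∩ connEvent ends a₁ b := (Set.inter_assoc _ _ _).symm
  rw [eTb, ebLoH]
  rw [mass_Q p h h2 hb3, mass_bL p h h2 hb3, mass_T p h h2 hb3, mass_TbL p h h2 hb3,
    mass_TbLoU p h h2 hb3, mass_oH p h h2 hb3, mass_bLoH p h h2 hb3, mass_ToU p h h2 hb3,
    mass_PD p h h2 hb3, mass_PDoU p h h2 hb3] at *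
  unfold lhs
  linear_combination (2 * mPD (p e₁) (p e₂) (cellsA1O p ends o a₁ a₂ b e₁ e₂) *
      mbL (p e₁) (p e₂) (cellsA1O p ends o a₁ a₂ b e₁ e₂)) * cT -
    (2 * mPD (p e₁) (p e₂) (cellsA1O p ends o a₁ a₂ b e₁ e₂) *
      mQ (p e₁) (p e₂) (cellsA1O p ends o a₁ a₂ b e₁ e₂)) * cTb

/-- **HALF-L on the class `a₃ ~ {a₁ o}`**, every weight. -/
theorem HalfL_a1o (p : E → R) (hp : IsProbVec p) {a₁ a₂ : V} (h : IsTwoMarkAt ends a₁ o a₃ e₁ e₂)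
    (h2 : a₂ ≠ a₃) (hb3 : b ≠ a₃) : HalfL p ends o a₁ a₂ a₃ b := by
  unfold HalfL
  rw [GammaLc_a1o p h h2 hb3]
  have := lhs_nonneg (p e₁) (p e₂) (cellsA1O p ends o a₁ a₂ b e₁ e₂)
    (cellsNonneg p hp ends o a₁ a₂ b e₁ e₂) (blocksNonneg p hp ends o a₁ a₂ b e₁ e₂)
    (hp.nonneg e₁) (hp.le_one e₁) (hp.nonneg e₂) (hp.le_one e₂)
  linarith

/-- **(HCOV) for `a₃ ~ {a₂, o}`**: HALF-L by `HalfLA2O.HalfL_a2o`, HALF-H = HALF-L of the root-swapped instance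
(class `a₃ ~ {first root, o}`) by `HalfL_a1o`. -/
theorem HCov_a2o (p : E → R) (hp : IsProbVec p) {a₁ a₂ : V} (h : IsTwoMarkAt ends a₂ o a₃ e₁ e₂)
    (h1 : a₁ ≠ a₃) (hb3 : b ≠ a₃) : HCov p ends o a₁ a₂ a₃ b :=
  HCov_of_HalfL_HalfH p ends o a₁ a₂ a₃ b (HalfLA2O.HalfL_a2o p hp h h1 hb3)
    ((HalfH_iff p ends o a₁ a₂ a₃ b).2 (HalfL_a1o p hp h h1 hb3))

/-- **(HCOV) for `a₃ ~ {a₁, o}`**: HALF-L by `HalfL_a1o`, HALF-H by `HalfLA2O.HalfL_a2o` on the root-swapped instance. -/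
theorem HCov_a1o (p : E → R) (hp : IsProbVec p) {a₁ a₂ : V} (h : IsTwoMarkAt ends a₁ o a₃ e₁ e₂)
    (h2 : a₂ ≠ a₃) (hb3 : b ≠ a₃) : HCov p ends o a₁ a₂ a₃ b :=
  HCov_of_HalfL_HalfH p ends o a₁ a₂ a₃ b (HalfL_a1o p hp h h2 hb3)
    ((HalfH_iff p ends o a₁ a₂ a₃ b).2 (HalfLA2O.HalfL_a2o p hp h h2 hb3))

end Main

end HalfLA1O

end Summit.Ventures.PercRepro2
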